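/-
Origin: expansion seat `prover-pub-hodgecm-own-htheta-0`, handover #H9 2026-08-21T05:26Z md5 16a9dd0c141f (306 l.; NEW additive KERNEL leaf beside E; imports binder-2 #106 `HodgeCM.Model.Binders.JLiuSlots23` (RUN 72) + #H8; ns HodgeCM.Model.ThetaAdelicSide; 2 theorems 0 defs: SLOTS 2 ∕ 3, same shape («∃ j, … ∧ ofLevel cf ∈ block j»), binder-2's `hJ_slot_{two,three}_of_lineRepOf` verbatim otherwise; ROWDEPS #106, #H8; NAMES for audit: HodgeCM.Model.ThetaAdelicSide.hJ_slot_two_block_of_lineRepOf · HodgeCM.Model.ThetaAdelicSide.hJ_slot_three_block_of_lineRepOf) (`HOME/pub-hodgecm-own-htheta/stage73/HodgeCM/Model/HThetaBlockSlots23.lean`, md5 16a9dd0c141f, 306 lines);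
landed by the gen-31 packager (p-g31) in gate run 73 as `HodgeCM/Model/HThetaBlockSlots23.lean` (verbatim).
-/
/-
Copyright (c) 2026 the pub-hodgecm formalisation cell (harness21).  New file, not vendored.
Origin: ROW-9 OWNER seat `prover-pub-hodgecm-own-htheta-0` (unit pub-hodgecm-own-htheta, named single owner of the (J-Liu-Θ) junction
theorem ∕ binder row 9 `hΘ`), 2026-08-21.  Target in PKG: `HodgeCM/Model/HThetaBlockSlots23.lean` (NEW additive KERNEL leaf beside E; imports
binder-2 #106 `HodgeCM.Model.Binders.JLiuSlots23` (RUN 72) + this seat's `HodgeCM.Model.HThetaBlockSlots01` (the single-block pin lemma); nothing imports it; outside E's import closure; E untouched; MODEL-N ±0).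
KERNEL ONLY: theorems; 0 defs, 0 records, nothing cited, 0 `def … : Prop`.  The section variable blocks and the proof bodies are binder-2-g20's
`Binders/JLiuSlots23.lean` VERBATIM (their pin-generic data and steps); what changes is the SHAPE OF THE CONCLUSION: ONE index `j_k` with
the tower vector IN `block j_k` (binder-2 exhibit `T := {{j_k}}` and conclude `∈ ⨆ j' ∈ T, block j'`, hiding the singleton behind `∃ T`).
Nothing here is a claim of the manuscripts under adjudication.
-/
import Summits.HodgeConjecture.HodgeCM.Model.Binders.JLiuSlots23
import Summits.HodgeConjecture.HodgeCM.Model.HThetaBlockSlots01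

set_option autoImplicit false

/-!
# (J3) THE JUNCTION BINDER, SLOTS 2 AND 3, PIN-GENERICALLY — ONE INDEX, ONE BLOCK (for the `Thm418C`-only junction)

binder-2-g20's `hJ_slot_k_of_lineRepOf` (`Binders/JLiuSlots23`) prove, for E's theta model over any side family reading `lineRepOf …` at
slot `k`, that every theta class is `res cf` of a level-`Γ` tower vector `cf` with `ofLevel cf ∈ ⨆ j' ∈ T, block j'` for a finite set `T`
of indices isometric to the slot line — and their proof takes `T := {{j_k}}`, `j_k` THE index of the `χ_k`-twisted slot record (theta-3 #S19
`LiuIndex.I.exists_line_eq_twistBy_bigCharOfV_of_eq`).  The statements below EXPOSE that: `∃ j, (line j ≅ ⟨a_k⟩) ∧ ∀ Γ ω, ∃ cf, res cf = ω ∧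
ofLevel cf ∈ block j`.  With the tower vector in ONE block, the combined reading `Thm418C` (r8) applies to it DIRECTLY (it is stated on
`block μ ∩ H^K`), so the junction needs neither Prop. 4.13's decomposition nor `Irreducible ∕ Thm418_2 ∕ MuSeparated` (this seat's
`Model/HsmallOfBlockAt`).  Hypotheses, section variables and proof steps: binder-2's, verbatim; the last step uses the single-block form
`mem_block_pin_of_line_eq_of_mem_biSup` of binder-2 #104 (over `LiuAlbaneseModuleDatum.biSup_iSup_range_le_block_of_surjective`).
`#print axioms` ⊆ {{propext, Classical.choice, Quot.sound}}.
-/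

noncomputable section

open NumberField hiding relNormOneIdeles relNormOneRat probHaarRelNormOneQuot
open _root_.NumberField.InfinitePlace _root_.NumberField.mixedEmbedding MeasureTheory MulAction IsDedekindDomain
open scoped Matrix TensorProduct Classical SchwartzMap
open Literature.Geometry.ComplexHyperbolic.BallModel (U21 x₀ stabilizerEquivK21)
open Literature.NumberTheory.Automorphic.U21 (K21 matA sclD)
open Literature.NumberTheory.Automorphic Literature.NumberTheory.Automorphic.UnitaryGroup Literature.NumberTheory.Weil1964
open Literature.NumberTheory.GelbartRogawski1991 Literature.NumberTheory.GelbartRogawski1991.UnitaryDualPair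
open Literature.AlgebraicGeometry.HodgeTheory Literature.AlgebraicGeometry.ShimuraVarieties Literature.AlgebraicGeometry.ShimuraVarieties.BallForms
open Literature.NumberTheory.Automorphic.PicardCM
open Literature.NumberTheory.Transcendental (Arapura2012_Cor_15_4_6)
open Literature.Analysis.SegalBargmann
open HodgeCM.Adelic HodgeCM.PerL34 HodgeCM.Model.HypCensus HodgeCM.Model.ArchSideTerm HodgeCM.Model.ThetaDistFin HodgeCM.Model.TowerCarrier
open HodgeCM.Model.SupplyInstance HodgeCM.Model.SupplyResidual HodgeCM.Model.ThetaSpace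
open HodgeCM.Model.SupplyResidual.WeilPairData (charInv)

open HodgeCM.Model.TowerLevel HodgeCM.Model.TowerCarrier

namespace HodgeCM.Model
namespace ThetaAdelicSide

variable (hHD : exists_isReal_hodgeModel) (hI : hodgePQ_independent_of_hodgeModel)
  (h₁ : BallQuotientUniformised) (h₃ : CMAbelianVarietyRealised) (hA : Arapura2012_Cor_15_4_6)
variable {L : CMField} {ι₁ : L →+* ℂ} (V : HermSpace3 L ι₁) (c : SeesawCtx L) (S : ThetaAdelicSide V c)
  (hGR : (cmSplittingDatum (L : Type) finProdFinEquiv (frameD V) (frameD_real V) (frameD_ne V) (dW c.D) (dW_real c.D)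
    (dW_ne c.D)).CompatibleSplitting)
  (hGR₀ : (cmSplittingDatum (L : Type) (e₁) (frameD V) (frameD_real V) (frameD_ne V) (lineVec (L : Type) (dW c.D 0))
    (fun _ => dW_real c.D 0) (fun _ => dW_ne c.D 0)).CompatibleSplitting)
  (hGR₁ : (cmSplittingDatum (L : Type) (e₁) (frameD V) (frameD_real V) (frameD_ne V) (lineVec (L : Type) (dW c.D 1))
    (fun _ => dW_real c.D 1) (fun _ => dW_ne c.D 1)).CompatibleSplitting)
  (hGR₂ : (cmSplittingDatum (L : Type) (e₁) (frameD V) (frameD_real V) (frameD_ne V) (lineVec (L : Type) (dW' c.D 0))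
    (fun _ => dW'_real c.D 0) (fun _ => dW'_ne c.D 0)).CompatibleSplitting)
  (hGR₃ : (cmSplittingDatum (L : Type) (e₁) (frameD V) (frameD_real V) (frameD_ne V) (lineVec (L : Type) (dW' c.D 1))
    (fun _ => dW'_real c.D 1) (fun _ => dW'_ne c.D 1)).CompatibleSplitting)
  (χ₀ χ₁ χ₂ χ₃ : CMAdelic (L : Type) (frameD V) × CMAdelicOne (L : Type) →* ℂˣ)
  (hι : S.ιinf = archInfOf V)
  (h₁W : (∀ j, 0 < (ι₁ (dW c.D j)).re) ∨ ∀ j, (ι₁ (dW c.D j)).re < 0)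
  (hV : IsAnisotropic L V.Hm)
  (hemb : (InfinitePlace.mk ι₁).embedding = ι₁)

variable (μ : LiuIndex.GramClass L → InfinitePlace (L : Type) → ℤ)

/-! ## Slot 2 -/

section Two

variable (hP : (S.P 2).ω = lineRepOf V c.D hGR hGR₀ hGR₁ hGR₂ hGR₃ χ₀ χ₁ χ₂ χ₃ 2)
  (hχc : Continuous fun p => ((χ₂ p : ℂˣ) : ℂ))
  (eR : PosIdx (cmXW (L : Type) (frameD V) (lineVec (L : Type) (dW' c.D 0)) (fun _ => dW'_real c.D 0) ι₁ (HypCensus.cmPlace (L : Type) ι₁)) ≃ Unit)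
  (eS : NegIdx (cmXW (L : Type) (frameD V) (lineVec (L : Type) (dW' c.D 0)) (fun _ => dW'_real c.D 0) ι₁ (HypCensus.cmPlace (L : Type) ι₁)) ≃ Empty)
  (hχ : ∀ u : stabilizer U21 x₀,
    ((lineScalar_two V c.D hGR hGR₂ hGR₃ χ₂ (u : U21) : ℂˣ) : ℂ) *
        ((matA (stabilizerEquivK21.symm u)).det ^ (lineVacExponentsTwo V c hGR₂ eR eS).eP *
          sclD (stabilizerEquivK21.symm u) ^ (lineVacExponentsTwo V c hGR₂ eR eS).eQ) =
      star (sclD (stabilizerEquivK21.symm u)))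
  (a : {v : InfinitePlace ↥(maximalRealSubfield L) // v.IsReal} → ℤ)
  (hω : ∀ b : {v : InfinitePlace ↥(maximalRealSubfield L) // v.IsReal}, b ≠ HypCensus.cmPlace (L : Type) ι₁ →
    ∀ (u : UnitaryGroup.archLocal (L : Type) 3 (Matrix.diagonal (frameD V)) (cmPlaceOver (L : Type) b)) (ℓ : Module.Dual ℂ (Fin 2 → ℂ)),
      cmArchWeilRep (L : Type) e₁ (frameD V) (frameD_real V) (frameD_ne V) (lineVec (L : Type) (dW' c.D 0)) (fun _ => dW'_real c.D 0)
          (fun _ => dW'_ne c.D 0) hGR₂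
          (UnitaryGroup.archSingle (↥(maximalRealSubfield L)) L (IsCMField.complexConj L) 3 (Matrix.diagonal (frameD V))
            (IsCMField.complexConj_ne_one L) (NumberField.complexConj_smul_infinitePlace (L : Type)) (cmPlaceOver (L : Type) b) u, 1)
          (blockFamilyOfAt (L : Type) e₁ (frameD V) (frameD_real V) (frameD_ne V) (lineVec (L : Type) (dW' c.D 0)) (fun _ => dW'_real c.D 0)
            (fun _ => dW'_ne c.D 0) ι₁ (blockPosEquiv V) (blockNegEquiv V) eR eS (degOnePDual Empty) (binvPi 1) ℓ) =
        (((u : UnitaryGroup.archLocal (L : Type) 3 (Matrix.diagonal (frameD V)) (cmPlaceOver (L : Type) b)) : GL (Fin 3) ℂ) :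
            Matrix (Fin 3) (Fin 3) ℂ).det ^ a b •
          blockFamilyOfAt (L : Type) e₁ (frameD V) (frameD_real V) (frameD_ne V) (lineVec (L : Type) (dW' c.D 0)) (fun _ => dW'_real c.D 0)
            (fun _ => dW'_ne c.D 0) ι₁ (blockPosEquiv V) (blockNegEquiv V) eR eS (degOnePDual Empty) (binvPi 1) ℓ)
  (hdefI : ∀ b : {v : InfinitePlace ↥(maximalRealSubfield L) // v.IsReal}, b ≠ HypCensus.cmPlace (L : Type) ι₁ →
    ∀ u : UnitaryGroup.archLocal (L : Type) 3 (Matrix.diagonal (frameD V)) (cmPlaceOver (L : Type) b),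
      ((archScalar_twoG V c.D hGR hGR₂ hGR₃ χ₂
          (UnitaryGroup.archSingle (↥(maximalRealSubfield L)) L (IsCMField.complexConj L) 3 (Matrix.diagonal (frameD V))
            (IsCMField.complexConj_ne_one L) (NumberField.complexConj_smul_infinitePlace (L : Type)) (cmPlaceOver (L : Type) b) u) : ℂˣ) : ℂ) *
        (((u : UnitaryGroup.archLocal (L : Type) 3 (Matrix.diagonal (frameD V)) (cmPlaceOver (L : Type) b)) : GL (Fin 3) ℂ) :
            Matrix (Fin 3) (Fin 3) ℂ).det ^ a b = 1)



include hGR hGR₀ hGR₁ hGR₂ hGR₃ χ₀ χ₁ χ₂ χ₃ hι h₁W hP hχc hemb eR eS hχ a hω hdefI in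
/-- **SLOT 2 OF THE JUNCTION BINDER `hJ`, PIN-GENERICALLY, FOR E's THETA MODEL** over any side family `Sf` with `Sf V c = S`, `S` reading
`lineRepOf … χ₀ χ₁ χ₂ χ₃` at slot 2 (R2 pin: `χ₁ := etaT₁ η ν`): the slot-2 conjunct through the χ₁-TWISTED record, ONE index `j₁`, tower vector IN `block j₁`,
modulo the ONE archimedean identity (`hμ` index side in #S19's split currency ∕ `hw` automorphy side, (Hw₁′)), the pin identities, and the
side facts `hGfin` ∕ `hLF` ∕ `hη₁V` ∕ `hη₁W`. -/
theorem hJ_slot_two_block_of_lineRepOf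
    (Sf : ∀ {L : CMField} {ι₁ : L →+* ℂ} (V : HermSpace3 L ι₁) (c : SeesawCtx L), ThetaAdelicSide V c)
    (hS : Sf V c = S)
    (hGfin : ∀ K : Subgroup ↥V.adelicFin, ThetaDistDatum.satG hV K ≤ S.Gfin) (hLF : (S.P 2).IsLFAction)
    (hη₁V : ∀ v ∈ CMRat (L : Type) (frameD V), χ₂ (v, 1) = 1)
    (hη₁W : ∀ t₀ ∈ relNormOneRat (↥(maximalRealSubfield L)) L, χ₂ (1, (cmAdelicOneEquivRelNormOne (L : Type)).symm t₀) = 1)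
    (hc₁ : Continuous fun v => ((adelicCharTwoG V c hGR hGR₂ hGR₃ χ₂ v : ℂˣ) : ℂ))
    (hμ : μ (LiuIndex.GramClass.mk (aTwoJ c)) =
      Literature.NumberTheory.Automorphic.charArchType (L : Type) (LiuIndex.centerCharInf V (adelicCharTwoG V c hGR hGR₂ hGR₃ χ₂))
          (LiuIndex.continuous_centerCharInf V _ hc₁) +
        LiuIndex.centralTypeOf V (aTwoJ c) hGR₂)
    (hw : ∀ t : ↥(Literature.NumberTheory.Automorphic.relNormOneInfUnits (↥(maximalRealSubfield L)) L),
      (S.P 2).w t *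
          ((adelicCharTwoG V c hGR hGR₂ hGR₃ χ₂ (CMCenter (L : Type) (frameD V)
            ((cmAdelicOneEquivRelNormOne (L : Type)).symm (Literature.NumberTheory.Automorphic.relNormOneInfToIdeles (↥(maximalRealSubfield L)) L t))) : ℂˣ) : ℂ) =
        ((torusScalar_twoG V c.D hGR hGR₂ hGR₃ χ₂
            ((cmAdelicOneEquivRelNormOne (L : Type)).symm (Literature.NumberTheory.Automorphic.relNormOneInfToIdeles (↥(maximalRealSubfield L)) L t)) : ℂˣ) : ℂ)) :
    ∃ j : LiuIndex.I V (LiuIndex.repAt (aTwoJ c)) μ,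
      (∃ z : (L : Type), z ≠ 0 ∧
        (LiuIndex.line V (LiuIndex.repAt (aTwoJ c)) μ j).scalar = z * conjRingHomK L z * c.D.a 2) ∧
      ∀ (Γ : Level V) (hΓ : Γ.BelowConjThree),
        ∀ ω ∈ thetaOf _ (thetaClassInputOf _ (fun V c => thetaSpaceInputOf hHD hI h₁ h₃ Sf V c)) V c 2 Γ,
          ∃ cf : towerLevel hHD hI (ballQuotientUniformisedDatum_of h₁) h₃ hA Γ hΓ,
            TowerLevel.res hHD hI (ballQuotientUniformisedDatum_of h₁) h₃ hA cf = ω ∧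
              (ofLevel hHD hI (ballQuotientUniformisedDatum_of h₁) h₃ hA Γ hΓ cf :
                  (liuDictionaryPin hHD hI h₁ h₃ hA V (LiuIndex.I V (LiuIndex.repAt (aTwoJ c)) μ)
                    (LiuIndex.line V (LiuIndex.repAt (aTwoJ c)) μ)).H) ∈
                (liuDictionaryPin hHD hI h₁ h₃ hA V (LiuIndex.I V (LiuIndex.repAt (aTwoJ c)) μ)
                  (LiuIndex.line V (LiuIndex.repAt (aTwoJ c)) μ)).block j := by
  -- theta-3 #S19: THE index of the twisted slot record, ONCE
  obtain ⟨j, hj1, hline⟩ : ∃ j : LiuIndex.I V (LiuIndex.repAt (aTwoJ c)) μ, j.1 = LiuIndex.GramClass.mk (aTwoJ c) ∧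
      LiuIndex.line V (LiuIndex.repAt (aTwoJ c)) μ j = splitLineTwoTwistedG V c hGR hGR₂ hGR₃ χ₂ hη₁V := by
    rw [splitLineTwoTwistedG_eq_ofCMOf_twistBy]
    exact LiuIndex.I.exists_line_eq_twistBy_bigCharOfV_of_eq V μ (LiuIndex.repAt_mk_self (aTwoJ c)) hGR₂ _ _ hc₁
      (bigCharTwoG_isRatTrivial V c hGR hGR₂ hGR₃ χ₂ hη₁V) hμ
  refine ⟨j, exists_isometric_of_line_eq V _ _ hline (splitLineTwoTwistedG_scalar V c hGR hGR₂ hGR₃ χ₂ hη₁V), fun Γ hΓ θ hθ => ?_⟩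
  -- sinst-1 #1238: the (J4) lift of the theta class (over the family `Sf`), moved to `S`
  obtain ⟨cl, hclω, -, F, hFsat₀, hpull₀, -⟩ := exists_fixed_adelic_lift_of_mem_thetaOf hHD hI h₁ h₃ Sf V c 2 Γ hV hθ
  have hFsat : (F : (V.latticeModel printFact_unitaryCompact_holds).G → (Fin 2 → ℂ)) ∈
      adelicThetaSpanSat (S.P 2) S.ιinf (stabilizer U21 x₀).subtype
        (BallForms.isPullbackCocycle_cotangentCocycle.weightOf x₀) (ThetaDistDatum.satG hV Γ.K) (S.P 2).weightFunctions := by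
    rw [← hS]; exact hFsat₀
  have hpull : (((pinD hHD hI h₁ h₃ Γ hV).pull cl : weightForms _ _ _) : U21 → Fin 2 → ℂ) =
      (F : (V.latticeModel printFact_unitaryCompact_holds).G → (Fin 2 → ℂ)) ∘ ⇑S.ιinf := by
    rw [← hS]; exact hpull₀
  have h𝓕 : ∀ f ∈ (S.P 2).weightFunctions,
      ∃ χ : PontryaginDual (↥(relNormOneIdeles (↥(maximalRealSubfield L)) L) ⧸ relNormOneRat (↥(maximalRealSubfield L)) L),
        f = charInv χ := fun f ⟨χ, _, hf⟩ => ⟨χ, hf⟩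
  -- binder-1 #R130 at #R129's pin-generic datum
  obtain ⟨hF', hx⟩ := clsU_mem_iSup_block_of_mem_adelicThetaSpanSat_pinTwoG hHD hI h₁ h₃ hA V c S hGR hGR₀ hGR₁ hGR₂ hGR₃
    χ₀ χ₁ χ₂ χ₃ hι h₁W hV hemb hP hχc eR eS hχ a hω hdefI h𝓕 hGfin hLF Γ.K hFsat
  have hhol : IsHolGerm S.ιinf (F : (V.latticeModel printFact_unitaryCompact_holds).G → (Fin 2 → ℂ)) := by
    obtain ⟨i, hi⟩ := (S.mem_holSatU_iff hV 2).1 hF'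
    exact ((S.mem_holSat_iff hV 2 i.1).1 hi).2
  -- binder-1 #1242∕#1243: tower vector and restriction
  refine ⟨⟨_, S.towerFamily_mem hHD hI h₁ h₃ hA hι hV hΓ hFsat hhol⟩, ?_, ?_⟩
  · rw [← hclω]
    exact S.res_towerFamily hHD hI h₁ h₃ hA hV hΓ hFsat hhol _ cl hpull
  have hFΓ : (F : (V.latticeModel printFact_unitaryCompact_holds).G → (Fin 2 → ℂ)) ∈ S.holSat hV 2 Γ (S.P 2).weightFunctions :=
    (S.mem_holSat_iff hV 2 Γ).2 ⟨hFsat, hhol⟩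
  have hU := S.clsU_eq_clsAt hHD hI h₁ h₃ hA hι hV 2 ⟨(F : _ → _), hF'⟩ ⟨Γ, hΓ⟩ hFΓ
  rw [clsAt_apply] at hU
  rw [← hU]
  -- binder-2 #104 over sinst-1 #1268∕#1269 and the (Hw₁′) identity
  exact mem_block_pin_of_line_eq_of_mem_biSup hHD hI h₁ h₃ hA V _ _
    (fun χ => ((pinDatumTwoG V c S hGR hGR₀ hGR₁ hGR₂ hGR₃ χ₀ χ₁ χ₂ χ₃ hι h₁W hV hemb hP hχc eR eS hχ a hω hdefI).coinvRep χ).asModule)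
    hline (fun χ => charTwoDictG V c hGR hGR₂ hGR₃ χ₂ χ)
    (fun χ hχ𝓕 => isAutChar_charTwoDictG_of_weight V c hGR hGR₂ hGR₃ χ₂ hχc hη₁V hη₁W h₁W χ _
      (WeilPairData.forall_weight_of_charInv_mem_weightFunctions _ hχ𝓕) hw)
    (fun χ _ => (dictEquivTwoCanonicalG V c S hGR hGR₀ hGR₁ hGR₂ hGR₃ χ₀ χ₁ χ₂ χ₃ hι h₁W hV hP hχc hη₁V _ _ _ χ).toLinearMap)
    (fun χ _ => LinearEquiv.surjective _) hx

end Two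

/-! ## Slot 3 -/

section Three

variable (hP : (S.P 3).ω = lineRepOf V c.D hGR hGR₀ hGR₁ hGR₂ hGR₃ χ₀ χ₁ χ₂ χ₃ 3)
  (hχc : Continuous fun p => ((χ₃ p : ℂˣ) : ℂ))
  (eR : PosIdx (cmXW (L : Type) (frameD V) (lineVec (L : Type) (dW' c.D 1)) (fun _ => dW'_real c.D 1) ι₁ (HypCensus.cmPlace (L : Type) ι₁)) ≃ Unit)
  (eS : NegIdx (cmXW (L : Type) (frameD V) (lineVec (L : Type) (dW' c.D 1)) (fun _ => dW'_real c.D 1) ι₁ (HypCensus.cmPlace (L : Type) ι₁)) ≃ Empty)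
  (hχ : ∀ u : stabilizer U21 x₀,
    ((lineScalar_three V c.D hGR hGR₂ hGR₃ χ₃ (u : U21) : ℂˣ) : ℂ) *
        ((matA (stabilizerEquivK21.symm u)).det ^ (lineVacExponentsThree V c hGR₃ eR eS).eP *
          sclD (stabilizerEquivK21.symm u) ^ (lineVacExponentsThree V c hGR₃ eR eS).eQ) =
      star (sclD (stabilizerEquivK21.symm u)))
  (a : {v : InfinitePlace ↥(maximalRealSubfield L) // v.IsReal} → ℤ)
  (hω : ∀ b : {v : InfinitePlace ↥(maximalRealSubfield L) // v.IsReal}, b ≠ HypCensus.cmPlace (L : Type) ι₁ →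
    ∀ (u : UnitaryGroup.archLocal (L : Type) 3 (Matrix.diagonal (frameD V)) (cmPlaceOver (L : Type) b)) (ℓ : Module.Dual ℂ (Fin 2 → ℂ)),
      cmArchWeilRep (L : Type) e₁ (frameD V) (frameD_real V) (frameD_ne V) (lineVec (L : Type) (dW' c.D 1)) (fun _ => dW'_real c.D 1)
          (fun _ => dW'_ne c.D 1) hGR₃
          (UnitaryGroup.archSingle (↥(maximalRealSubfield L)) L (IsCMField.complexConj L) 3 (Matrix.diagonal (frameD V))
            (IsCMField.complexConj_ne_one L) (NumberField.complexConj_smul_infinitePlace (L : Type)) (cmPlaceOver (L : Type) b) u, 1)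
          (blockFamilyOfAt (L : Type) e₁ (frameD V) (frameD_real V) (frameD_ne V) (lineVec (L : Type) (dW' c.D 1)) (fun _ => dW'_real c.D 1)
            (fun _ => dW'_ne c.D 1) ι₁ (blockPosEquiv V) (blockNegEquiv V) eR eS (degOnePDual Empty) (binvPi 1) ℓ) =
        (((u : UnitaryGroup.archLocal (L : Type) 3 (Matrix.diagonal (frameD V)) (cmPlaceOver (L : Type) b)) : GL (Fin 3) ℂ) :
            Matrix (Fin 3) (Fin 3) ℂ).det ^ a b •
          blockFamilyOfAt (L : Type) e₁ (frameD V) (frameD_real V) (frameD_ne V) (lineVec (L : Type) (dW' c.D 1)) (fun _ => dW'_real c.D 1)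
            (fun _ => dW'_ne c.D 1) ι₁ (blockPosEquiv V) (blockNegEquiv V) eR eS (degOnePDual Empty) (binvPi 1) ℓ)
  (hdefI : ∀ b : {v : InfinitePlace ↥(maximalRealSubfield L) // v.IsReal}, b ≠ HypCensus.cmPlace (L : Type) ι₁ →
    ∀ u : UnitaryGroup.archLocal (L : Type) 3 (Matrix.diagonal (frameD V)) (cmPlaceOver (L : Type) b),
      ((archScalar_threeG V c.D hGR hGR₂ hGR₃ χ₃
          (UnitaryGroup.archSingle (↥(maximalRealSubfield L)) L (IsCMField.complexConj L) 3 (Matrix.diagonal (frameD V))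
            (IsCMField.complexConj_ne_one L) (NumberField.complexConj_smul_infinitePlace (L : Type)) (cmPlaceOver (L : Type) b) u) : ℂˣ) : ℂ) *
        (((u : UnitaryGroup.archLocal (L : Type) 3 (Matrix.diagonal (frameD V)) (cmPlaceOver (L : Type) b)) : GL (Fin 3) ℂ) :
            Matrix (Fin 3) (Fin 3) ℂ).det ^ a b = 1)



include hGR hGR₀ hGR₁ hGR₂ hGR₃ χ₀ χ₁ χ₂ χ₃ hι h₁W hP hχc hemb eR eS hχ a hω hdefI in
/-- **SLOT 3 OF THE JUNCTION BINDER `hJ`, PIN-GENERICALLY, FOR E's THETA MODEL** over any side family `Sf` with `Sf V c = S`, `S` reading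
`lineRepOf … χ₀ χ₁ χ₂ χ₃` at slot 3 (R2 pin: `χ₁ := etaT₁ η ν`): the slot-3 conjunct through the χ₁-TWISTED record, ONE index `j₁`, tower vector IN `block j₁`,
modulo the ONE archimedean identity (`hμ` index side in #S19's split currency ∕ `hw` automorphy side, (Hw₁′)), the pin identities, and the
side facts `hGfin` ∕ `hLF` ∕ `hη₁V` ∕ `hη₁W`. -/
theorem hJ_slot_three_block_of_lineRepOf
    (Sf : ∀ {L : CMField} {ι₁ : L →+* ℂ} (V : HermSpace3 L ι₁) (c : SeesawCtx L), ThetaAdelicSide V c)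
    (hS : Sf V c = S)
    (hGfin : ∀ K : Subgroup ↥V.adelicFin, ThetaDistDatum.satG hV K ≤ S.Gfin) (hLF : (S.P 3).IsLFAction)
    (hη₁V : ∀ v ∈ CMRat (L : Type) (frameD V), χ₃ (v, 1) = 1)
    (hη₁W : ∀ t₀ ∈ relNormOneRat (↥(maximalRealSubfield L)) L, χ₃ (1, (cmAdelicOneEquivRelNormOne (L : Type)).symm t₀) = 1)
    (hc₁ : Continuous fun v => ((adelicCharThree V c hGR hGR₂ hGR₃ χ₃ v : ℂˣ) : ℂ))
    (hμ : μ (LiuIndex.GramClass.mk (aThreeJ c)) =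
      Literature.NumberTheory.Automorphic.charArchType (L : Type) (LiuIndex.centerCharInf V (adelicCharThree V c hGR hGR₂ hGR₃ χ₃))
          (LiuIndex.continuous_centerCharInf V _ hc₁) +
        LiuIndex.centralTypeOf V (aThreeJ c) hGR₃)
    (hw : ∀ t : ↥(Literature.NumberTheory.Automorphic.relNormOneInfUnits (↥(maximalRealSubfield L)) L),
      (S.P 3).w t *
          ((adelicCharThree V c hGR hGR₂ hGR₃ χ₃ (CMCenter (L : Type) (frameD V)
            ((cmAdelicOneEquivRelNormOne (L : Type)).symm (Literature.NumberTheory.Automorphic.relNormOneInfToIdeles (↥(maximalRealSubfield L)) L t))) : ℂˣ) : ℂ) =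
        ((torusScalar_threeG V c.D hGR hGR₂ hGR₃ χ₃
            ((cmAdelicOneEquivRelNormOne (L : Type)).symm (Literature.NumberTheory.Automorphic.relNormOneInfToIdeles (↥(maximalRealSubfield L)) L t)) : ℂˣ) : ℂ)) :
    ∃ j : LiuIndex.I V (LiuIndex.repAt (aThreeJ c)) μ,
      (∃ z : (L : Type), z ≠ 0 ∧
        (LiuIndex.line V (LiuIndex.repAt (aThreeJ c)) μ j).scalar = z * conjRingHomK L z * c.D.a 3) ∧
      ∀ (Γ : Level V) (hΓ : Γ.BelowConjThree),
        ∀ ω ∈ thetaOf _ (thetaClassInputOf _ (fun V c => thetaSpaceInputOf hHD hI h₁ h₃ Sf V c)) V c 3 Γ,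
          ∃ cf : towerLevel hHD hI (ballQuotientUniformisedDatum_of h₁) h₃ hA Γ hΓ,
            TowerLevel.res hHD hI (ballQuotientUniformisedDatum_of h₁) h₃ hA cf = ω ∧
              (ofLevel hHD hI (ballQuotientUniformisedDatum_of h₁) h₃ hA Γ hΓ cf :
                  (liuDictionaryPin hHD hI h₁ h₃ hA V (LiuIndex.I V (LiuIndex.repAt (aThreeJ c)) μ)
                    (LiuIndex.line V (LiuIndex.repAt (aThreeJ c)) μ)).H) ∈
                (liuDictionaryPin hHD hI h₁ h₃ hA V (LiuIndex.I V (LiuIndex.repAt (aThreeJ c)) μ)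
                  (LiuIndex.line V (LiuIndex.repAt (aThreeJ c)) μ)).block j := by
  -- theta-3 #S19: THE index of the twisted slot record, ONCE
  obtain ⟨j, hj1, hline⟩ : ∃ j : LiuIndex.I V (LiuIndex.repAt (aThreeJ c)) μ, j.1 = LiuIndex.GramClass.mk (aThreeJ c) ∧
      LiuIndex.line V (LiuIndex.repAt (aThreeJ c)) μ j = splitLineThreeTwistedG V c hGR hGR₂ hGR₃ χ₃ hη₁V := by
    rw [splitLineThreeTwistedG_eq_ofCMOf_twistBy]
    exact LiuIndex.I.exists_line_eq_twistBy_bigCharOfV_of_eq V μ (LiuIndex.repAt_mk_self (aThreeJ c)) hGR₃ _ _ hc₁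
      (bigCharThree_isRatTrivial V c hGR hGR₂ hGR₃ χ₃ hη₁V) hμ
  refine ⟨j, exists_isometric_of_line_eq V _ _ hline (splitLineThreeTwistedG_scalar V c hGR hGR₂ hGR₃ χ₃ hη₁V), fun Γ hΓ θ hθ => ?_⟩
  -- sinst-1 #1238: the (J4) lift of the theta class (over the family `Sf`), moved to `S`
  obtain ⟨cl, hclω, -, F, hFsat₀, hpull₀, -⟩ := exists_fixed_adelic_lift_of_mem_thetaOf hHD hI h₁ h₃ Sf V c 3 Γ hV hθ
  have hFsat : (F : (V.latticeModel printFact_unitaryCompact_holds).G → (Fin 2 → ℂ)) ∈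
      adelicThetaSpanSat (S.P 3) S.ιinf (stabilizer U21 x₀).subtype
        (BallForms.isPullbackCocycle_cotangentCocycle.weightOf x₀) (ThetaDistDatum.satG hV Γ.K) (S.P 3).weightFunctions := by
    rw [← hS]; exact hFsat₀
  have hpull : (((pinD hHD hI h₁ h₃ Γ hV).pull cl : weightForms _ _ _) : U21 → Fin 2 → ℂ) =
      (F : (V.latticeModel printFact_unitaryCompact_holds).G → (Fin 2 → ℂ)) ∘ ⇑S.ιinf := by
    rw [← hS]; exact hpull₀
  have h𝓕 : ∀ f ∈ (S.P 3).weightFunctions,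
      ∃ χ : PontryaginDual (↥(relNormOneIdeles (↥(maximalRealSubfield L)) L) ⧸ relNormOneRat (↥(maximalRealSubfield L)) L),
        f = charInv χ := fun f ⟨χ, _, hf⟩ => ⟨χ, hf⟩
  -- binder-1 #R130 at #R129's pin-generic datum
  obtain ⟨hF', hx⟩ := clsU_mem_iSup_block_of_mem_adelicThetaSpanSat_pinThreeG hHD hI h₁ h₃ hA V c S hGR hGR₀ hGR₁ hGR₂ hGR₃
    χ₀ χ₁ χ₂ χ₃ hι hV hemb hP hχc eR eS hχ a hω hdefI h𝓕 hGfin hLF Γ.K hFsat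
  have hhol : IsHolGerm S.ιinf (F : (V.latticeModel printFact_unitaryCompact_holds).G → (Fin 2 → ℂ)) := by
    obtain ⟨i, hi⟩ := (S.mem_holSatU_iff hV 3).1 hF'
    exact ((S.mem_holSat_iff hV 3 i.1).1 hi).2
  -- binder-1 #1242∕#1243: tower vector and restriction
  refine ⟨⟨_, S.towerFamily_mem hHD hI h₁ h₃ hA hι hV hΓ hFsat hhol⟩, ?_, ?_⟩
  · rw [← hclω]
    exact S.res_towerFamily hHD hI h₁ h₃ hA hV hΓ hFsat hhol _ cl hpull
  have hFΓ : (F : (V.latticeModel printFact_unitaryCompact_holds).G → (Fin 2 → ℂ)) ∈ S.holSat hV 3 Γ (S.P 3).weightFunctions :=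
    (S.mem_holSat_iff hV 3 Γ).2 ⟨hFsat, hhol⟩
  have hU := S.clsU_eq_clsAt hHD hI h₁ h₃ hA hι hV 3 ⟨(F : _ → _), hF'⟩ ⟨Γ, hΓ⟩ hFΓ
  rw [clsAt_apply] at hU
  rw [← hU]
  -- binder-2 #104 over sinst-1 #1270∕#1271 and the (Hw₁′) identity
  exact mem_block_pin_of_line_eq_of_mem_biSup hHD hI h₁ h₃ hA V _ _
    (fun χ => ((pinDatumThreeG V c S hGR hGR₀ hGR₁ hGR₂ hGR₃ χ₀ χ₁ χ₂ χ₃ hι hV hemb hP hχc eR eS hχ a hω hdefI).coinvRep χ).asModule)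
    hline (fun χ => charThreeDictG V c hGR hGR₂ hGR₃ χ₃ χ)
    (fun χ hχ𝓕 => isAutChar_charThreeDictG_of_weight V c hGR hGR₂ hGR₃ χ₃ hχc hη₁V hη₁W h₁W χ _
      (WeilPairData.forall_weight_of_charInv_mem_weightFunctions _ hχ𝓕) hw)
    (fun χ _ => (dictEquivThreeCanonicalG V c S hGR hGR₀ hGR₁ hGR₂ hGR₃ χ₀ χ₁ χ₂ χ₃ hι hV hP hχc hη₁V _ _ _ χ).toLinearMap)
    (fun χ _ => LinearEquiv.surjective _) hx

end Three

end ThetaAdelicSide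
end HodgeCM.Model

end
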